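import Summits.RiemannHypothesis.RiemannHypothesis.Theorems.WeilFormatCPolyWindowMixedArch
import Summits.RiemannHypothesis.RiemannHypothesis.Theorems.WeilFormatCPolyWindowPole
import Summits.RiemannHypothesis.RiemannHypothesis.Theorems.WeilFormatCEntryPole
import HarnessLib

/-!
# Format C, design C∞ (L2–VII): the mixed entries `W_a(x^j·1_{[−a,a]}, χ_m)` assembled

Route context: Fourier–Galerkin / Schur-complement certificates of Weil positivity on a window ("format C";
cell memo `run/shared/lean/pub/rh-explicit/rh-explicit-weil-10/FORMATC-DESIGN.md` §9.12.7–§9.12.11, KERNEL-LEVER.md §11–§13;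
supporting stmt-RiemannHypothesis-0098; seat rh-explicit-weil-10).  Assembles `WeilFormatCPolyWindowMixed{Increment,Arch}.lean`
with the pole integrals of `WeilFormatCPolyWindowPole.lean` / `WeilFormatCEntryPole.lean` into the four pieces of
`weilWindowSesq a (1x^j) (χ_m) = P + PRIME + ARCH − M_a⟨1x^j, χ_m⟩` (`WeilFormatCDefs.weilWindowSesq_eq`), `m ≠ 0`
(the column `m = 0` is `(2a)^{-1/2}` times the monomial table, `weilWindowSesq_chi_zero_right`):

* `weilPoleSesq_indicator_pow_chi` — `P(1x^j, χ_m) = 2C_j·P^c_m + 2S_j·P^s_m·i` with the real pole integrals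
  `C_j, S_j` of `x^j` (`…Pole.lean`) and `P^c_m`, `P^s_m` of `χ_m` (`…EntryPole.lean`);
* `setIntegral_Ioc_weilArchDensity_mul_weilIncrementSesq_indicator_pow_chi` — the window-scale archimedean integral as
  `(2a)^{-1/2}(−1)^m Σ_k (−1)^k j^{(k)}/(−iω_m)^{k+1}·[a^{j−k} J⁺ − (−a)^{j−k} J⁻ + ∫ρP_{j−k}]`, `J^± = ∫_{(0,2a]} ρ(1 − e^{±iω_m t})`
  (`= J_c ∓ iJ_s`, digamma closed forms in `…MixedArch.lean`), `∫ρ P_q` through the window constants;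
* `setIntegral_weilArchDensity_mul_weilIncrementSesq_indicator_pow_chi` — plus the tail `2⟨1x^j, χ_m⟩ ∫_{(2a,∞)} ρ`;
* **`weilWindowSesq_indicator_pow_chi`** — the assembled entry.

Pure calculus; standard axioms; no RH claim.
-/

set_option autoImplicit false
-- `Summit.RiemannHypothesis.RiemannHypothesis.…` is the layout-mandated namespace (summit = problem name).
set_option linter.dupNamespace false

noncomputable section

open Complex Filter Set MeasureTheory
open scoped Real Topology ComplexConjugate ArithmeticFunction.vonMangoldt

namespace Summit.RiemannHypothesis.RiemannHypothesis.Theorems.WeilFormatC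

open Literature.NumberTheory.LFunctions Literature.NumberTheory.LFunctions.Yoshida1992
  Literature.Analysis.SpecialFunctions

variable {a : ℝ}

/-! ## The mixed pole form -/

/-- **The pole form of a monomial window against `χ_m`** (`a > 0`):
`P(1x^j, χ_m) = 2 C_j P^c_m + 2 S_j P^s_m · i`, where `C_j = ∫_{−a}^{a} x^j cosh(x/2)`, `S_j = ∫_{−a}^{a} x^j sinh(x/2)`,
`P^c_m = (−1)^m 2(e^{a/2} − e^{−a/2})/((2a)^{1/2}(1 + 4ω_m²))` and `P^s_m = −(−1)^m 4ω_m(e^{a/2} − e^{−a/2})/((2a)^{1/2}(1 + 4ω_m²))`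
(`∫χ_m cosh = P^c_m`, `∫χ_m sinh = P^s_m·i`). -/
theorem weilPoleSesq_indicator_pow_chi (ha : 0 < a) (j : ℕ) (m : ℤ) :
    weilPoleSesq ((Icc (-a) a).indicator fun x : ℝ ↦ ((x : ℂ)) ^ j) (chi a m) =
      ((2 * (∫ x in (-a)..a, x ^ j * Real.cosh (x / 2)) *
          ((-1 : ℝ) ^ m * (2 * (Real.exp (a / 2) - Real.exp (-(a / 2)))) /
            (Real.sqrt (2 * a) * (1 + 4 * (π * m / a) ^ 2))) : ℝ) : ℂ) +
        ((2 * (∫ x in (-a)..a, x ^ j * Real.sinh (x / 2)) *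
          (-((-1 : ℝ) ^ m * (4 * (π * m / a) * (Real.exp (a / 2) - Real.exp (-(a / 2))))) /
            (Real.sqrt (2 * a) * (1 + 4 * (π * m / a) ^ 2))) : ℝ) : ℂ) * I := by
  unfold weilPoleSesq
  rw [integral_indicator_pow_mul_cosh ha.le, integral_indicator_pow_mul_sinh ha.le, integral_chi_mul_cosh ha m,
    integral_chi_mul_sinh ha m, map_mul, Complex.conj_ofReal, Complex.conj_ofReal, Complex.conj_I]
  push_cast
  ring

/-! ## The mixed archimedean block -/

/-- **The window-scale archimedean integral of the mixed pairing** (`a > 0`, `m ≠ 0`):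
`∫_{(0,2a]} ρ(t) D_t(1x^j, χ_m) dt = (2a)^{-1/2}(−1)^m Σ_{k≤j} (−1)^k j^{(k)}/(−iω_m)^{k+1} ·
  [a^{j−k} ∫_{(0,2a]}ρ(1 − e^{iω_m t}) − (−a)^{j−k} ∫_{(0,2a]}ρ(1 − e^{−iω_m t}) + ∫_{(0,2a]} ρ P_{j−k}]`. -/
theorem setIntegral_Ioc_weilArchDensity_mul_weilIncrementSesq_indicator_pow_chi (ha : 0 < a) {m : ℤ} (hm : m ≠ 0)
    (j : ℕ) :
    ∫ t in Ioc 0 (2 * a), (weilArchDensity t : ℂ) *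
        weilIncrementSesq ((Icc (-a) a).indicator fun x : ℝ ↦ ((x : ℂ)) ^ j) (chi a m) t =
      ((1 / Real.sqrt (2 * a) : ℝ) : ℂ) * (-1 : ℂ) ^ m *
        ∑ k ∈ Finset.range (j + 1), (-1 : ℂ) ^ k * (j.descFactorial k : ℂ) / (-(I * (π * m / a : ℝ))) ^ (k + 1) *
          (((a : ℂ)) ^ (j - k) *
              (∫ t in Ioc 0 (2 * a), (weilArchDensity t : ℂ) * (1 - cexp (I * ((π * m / a : ℝ) : ℂ) * (t : ℂ))))
            - (((-a : ℝ)) : ℂ) ^ (j - k) *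
              (∫ t in Ioc 0 (2 * a), (weilArchDensity t : ℂ) * (1 - cexp (-(I * ((π * m / a : ℝ) : ℂ) * (t : ℂ)))))
            + ((∫ t in Ioc 0 (2 * a), weilArchDensity t *
                ((a ^ (j - k) - (a - t) ^ (j - k)) + ((-a + t) ^ (j - k) - (-a) ^ (j - k))) : ℝ) : ℂ)) := by
  -- the integrand, term by term
  set F : ℕ → ℝ → ℂ := fun k t ↦
    ((a : ℂ)) ^ (j - k) * ((weilArchDensity t : ℂ) * (1 - cexp (I * ((π * m / a : ℝ) : ℂ) * (t : ℂ))))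
      - (((-a : ℝ)) : ℂ) ^ (j - k) * ((weilArchDensity t : ℂ) * (1 - cexp (-(I * ((π * m / a : ℝ) : ℂ) * (t : ℂ)))))
      + ((weilArchDensity t * ((a ^ (j - k) - (a - t) ^ (j - k)) + ((-a + t) ^ (j - k) - (-a) ^ (j - k))) : ℝ) : ℂ)
    with hF
  have hpt : EqOn (fun t ↦ (weilArchDensity t : ℂ) *
      weilIncrementSesq ((Icc (-a) a).indicator fun x : ℝ ↦ ((x : ℂ)) ^ j) (chi a m) t)
      (fun t ↦ ∑ k ∈ Finset.range (j + 1),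
        (((1 / Real.sqrt (2 * a) : ℝ) : ℂ) * (-1 : ℂ) ^ m *
          ((-1 : ℂ) ^ k * (j.descFactorial k : ℂ) / (-(I * (π * m / a : ℝ))) ^ (k + 1))) * F k t)
      (Ioc 0 (2 * a)) := by
    intro t ht
    simp only [hF]
    rw [weilIncrementSesq_indicator_pow_chi ha hm j ht.1.le ht.2, Finset.mul_sum, Finset.mul_sum]
    refine Finset.sum_congr rfl fun k _ ↦ ?_
    push_cast
    ring
  -- integrability of each term
  have iE := integrableOn_weilArchDensity_mul_one_sub_cexp ha (π * m / a)
  have iE' := integrableOn_weilArchDensity_mul_one_sub_cexp_neg ha (π * m / a)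
  have iP : ∀ k : ℕ, IntegrableOn (fun t ↦ ((weilArchDensity t *
      ((a ^ (j - k) - (a - t) ^ (j - k)) + ((-a + t) ^ (j - k) - (-a) ^ (j - k))) : ℝ) : ℂ)) (Ioc 0 (2 * a)) :=
    fun k ↦ (integrableOn_weilArchDensity_mul_mixedPolyKernel ha (j - k)).ofReal
  have iA : ∀ k : ℕ, IntegrableOn (fun t ↦ ((a : ℂ)) ^ (j - k) *
      ((weilArchDensity t : ℂ) * (1 - cexp (I * ((π * m / a : ℝ) : ℂ) * (t : ℂ))))) (Ioc 0 (2 * a)) :=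
    fun k ↦ iE.const_mul _
  have iB : ∀ k : ℕ, IntegrableOn (fun t ↦ (((-a : ℝ)) : ℂ) ^ (j - k) *
      ((weilArchDensity t : ℂ) * (1 - cexp (-(I * ((π * m / a : ℝ) : ℂ) * (t : ℂ)))))) (Ioc 0 (2 * a)) :=
    fun k ↦ iE'.const_mul _
  have iAB : ∀ k : ℕ, IntegrableOn (fun t ↦ ((a : ℂ)) ^ (j - k) *
      ((weilArchDensity t : ℂ) * (1 - cexp (I * ((π * m / a : ℝ) : ℂ) * (t : ℂ)))) - (((-a : ℝ)) : ℂ) ^ (j - k) *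
      ((weilArchDensity t : ℂ) * (1 - cexp (-(I * ((π * m / a : ℝ) : ℂ) * (t : ℂ)))))) (Ioc 0 (2 * a)) :=
    fun k ↦ (iA k).sub (iB k)
  have iF : ∀ k : ℕ, IntegrableOn (F k) (Ioc 0 (2 * a)) := fun k ↦ (iAB k).add (iP k)
  have iF' : ∀ k ∈ Finset.range (j + 1), IntegrableOn (fun t ↦
      (((1 / Real.sqrt (2 * a) : ℝ) : ℂ) * (-1 : ℂ) ^ m *
        ((-1 : ℂ) ^ k * (j.descFactorial k : ℂ) / (-(I * (π * m / a : ℝ))) ^ (k + 1))) * F k t)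
      (Ioc 0 (2 * a)) := fun k _ ↦ (iF k).const_mul _
  rw [setIntegral_congr_fun measurableSet_Ioc hpt, integral_finsetSum _ iF', Finset.mul_sum]
  refine Finset.sum_congr rfl fun k _ ↦ ?_
  rw [MeasureTheory.integral_const_mul]
  have hval : ∫ t in Ioc 0 (2 * a), F k t =
      ((a : ℂ)) ^ (j - k) *
          (∫ t in Ioc 0 (2 * a), (weilArchDensity t : ℂ) * (1 - cexp (I * ((π * m / a : ℝ) : ℂ) * (t : ℂ))))
        - (((-a : ℝ)) : ℂ) ^ (j - k) *
            (∫ t in Ioc 0 (2 * a), (weilArchDensity t : ℂ) * (1 - cexp (-(I * ((π * m / a : ℝ) : ℂ) * (t : ℂ)))))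
        + ((∫ t in Ioc 0 (2 * a), weilArchDensity t *
            ((a ^ (j - k) - (a - t) ^ (j - k)) + ((-a + t) ^ (j - k) - (-a) ^ (j - k))) : ℝ) : ℂ) := by
    simp only [hF]
    rw [integral_add (iAB k) (iP k), integral_sub (iA k) (iB k), MeasureTheory.integral_const_mul,
      MeasureTheory.integral_const_mul, integral_complex_ofReal]
  rw [hval]
  ring

/-- **The archimedean block of a monomial window against `χ_m`** (`a > 0`, `m ≠ 0`): the window-scale integral of
`setIntegral_Ioc_weilArchDensity_mul_weilIncrementSesq_indicator_pow_chi` plus the tail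
`2⟨1x^j, χ_m⟩ ∫_{(2a,∞)} ρ = 2(2a)^{-1/2} c_m(x^j) ∫_{(2a,∞)} ρ`. -/
theorem setIntegral_weilArchDensity_mul_weilIncrementSesq_indicator_pow_chi (ha : 0 < a) {m : ℤ} (hm : m ≠ 0) (j : ℕ) :
    ∫ t in Ioi 0, (weilArchDensity t : ℂ) *
        weilIncrementSesq ((Icc (-a) a).indicator fun x : ℝ ↦ ((x : ℂ)) ^ j) (chi a m) t =
      ((1 / Real.sqrt (2 * a) : ℝ) : ℂ) * (-1 : ℂ) ^ m *
        (∑ k ∈ Finset.range (j + 1), (-1 : ℂ) ^ k * (j.descFactorial k : ℂ) / (-(I * (π * m / a : ℝ))) ^ (k + 1) *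
          (((a : ℂ)) ^ (j - k) *
              (∫ t in Ioc 0 (2 * a), (weilArchDensity t : ℂ) * (1 - cexp (I * ((π * m / a : ℝ) : ℂ) * (t : ℂ))))
            - (((-a : ℝ)) : ℂ) ^ (j - k) *
              (∫ t in Ioc 0 (2 * a), (weilArchDensity t : ℂ) * (1 - cexp (-(I * ((π * m / a : ℝ) : ℂ) * (t : ℂ)))))
            + ((∫ t in Ioc 0 (2 * a), weilArchDensity t *
                ((a ^ (j - k) - (a - t) ^ (j - k)) + ((-a + t) ^ (j - k) - (-a) ^ (j - k))) : ℝ) : ℂ)))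
        + 2 * (((1 / Real.sqrt (2 * a) : ℝ) : ℂ) * Yoshida1992.fourierCoeff a m (fun x : ℝ ↦ ((x : ℂ)) ^ j)) *
            ((∫ t in Ioi (2 * a), weilArchDensity t : ℝ) : ℂ) := by
  have hchi : IsWindowFunction a (chi a m) := isWindowFunction_chi ha m
  rw [setIntegral_weilArchDensity_mul_weilIncrementSesq_split ha (isWindowFunction_indicator_pow a j) hchi,
    setIntegral_Ioc_weilArchDensity_mul_weilIncrementSesq_indicator_pow_chi ha hm,
    integral_indicator_pow_mul_conj_chi ha.le]

/-! ## The assembled mixed entry -/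

/-- **The window form of a monomial window against `χ_m`, assembled** (`a > 0`, `m ≠ 0`):
`W_a(1x^j, χ_m) = P(1x^j, χ_m) + (Σ_{log n<2a} Λ(n)n^{-1/2} D_{log n}(1x^j, χ_m) + ∫₀^∞ ρ D_t(1x^j, χ_m) dt)
  − M_a (2a)^{-1/2} c_m(x^j)` with every piece in the closed forms of this file and its siblings
(`weilPoleSesq_indicator_pow_chi`, `sum_prime_weilIncrementSesq_indicator_pow_chi`,
`setIntegral_weilArchDensity_mul_weilIncrementSesq_indicator_pow_chi`, `fourierCoeff_ofReal_pow_eq_sum`). -/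
theorem weilWindowSesq_indicator_pow_chi (ha : 0 < a) {m : ℤ} (hm : m ≠ 0) (j : ℕ) :
    weilWindowSesq a ((Icc (-a) a).indicator fun x : ℝ ↦ ((x : ℂ)) ^ j) (chi a m) =
      (((2 * (∫ x in (-a)..a, x ^ j * Real.cosh (x / 2)) *
            ((-1 : ℝ) ^ m * (2 * (Real.exp (a / 2) - Real.exp (-(a / 2)))) /
              (Real.sqrt (2 * a) * (1 + 4 * (π * m / a) ^ 2))) : ℝ) : ℂ) +
          ((2 * (∫ x in (-a)..a, x ^ j * Real.sinh (x / 2)) *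
            (-((-1 : ℝ) ^ m * (4 * (π * m / a) * (Real.exp (a / 2) - Real.exp (-(a / 2))))) /
              (Real.sqrt (2 * a) * (1 + 4 * (π * m / a) ^ 2))) : ℝ) : ℂ) * I)
      + ((∑ n ∈ weilPrimeIndex a, ((Λ n : ℝ) / Real.sqrt n : ℂ) *
            (((1 / Real.sqrt (2 * a) : ℝ) : ℂ) * (-1 : ℂ) ^ m *
              ∑ k ∈ Finset.range (j + 1), (-1 : ℂ) ^ k * (j.descFactorial k : ℂ) / (-(I * (π * m / a : ℝ))) ^ (k + 1) *
                (((a : ℂ)) ^ (j - k) * (1 - cexp (I * (π * m / a : ℝ) * (Real.log n : ℝ)))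
                  - (((-a : ℝ)) : ℂ) ^ (j - k) * (1 - cexp (-(I * (π * m / a : ℝ) * (Real.log n : ℝ))))
                  + (((a : ℂ)) ^ (j - k) - (((a - Real.log n : ℝ)) : ℂ) ^ (j - k))
                  + ((((-a + Real.log n : ℝ)) : ℂ) ^ (j - k) - (((-a : ℝ)) : ℂ) ^ (j - k)))))
        + (((1 / Real.sqrt (2 * a) : ℝ) : ℂ) * (-1 : ℂ) ^ m *
            (∑ k ∈ Finset.range (j + 1), (-1 : ℂ) ^ k * (j.descFactorial k : ℂ) / (-(I * (π * m / a : ℝ))) ^ (k + 1) *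
              (((a : ℂ)) ^ (j - k) *
                  (∫ t in Ioc 0 (2 * a), (weilArchDensity t : ℂ) * (1 - cexp (I * ((π * m / a : ℝ) : ℂ) * (t : ℂ))))
                - (((-a : ℝ)) : ℂ) ^ (j - k) *
                  (∫ t in Ioc 0 (2 * a), (weilArchDensity t : ℂ) *
                    (1 - cexp (-(I * ((π * m / a : ℝ) : ℂ) * (t : ℂ)))))
                + ((∫ t in Ioc 0 (2 * a), weilArchDensity t *
                    ((a ^ (j - k) - (a - t) ^ (j - k)) + ((-a + t) ^ (j - k) - (-a) ^ (j - k))) : ℝ) : ℂ)))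
          + 2 * (((1 / Real.sqrt (2 * a) : ℝ) : ℂ) * Yoshida1992.fourierCoeff a m (fun x : ℝ ↦ ((x : ℂ)) ^ j)) *
              ((∫ t in Ioi (2 * a), weilArchDensity t : ℝ) : ℂ)))
      - (weilMarkovConstant a : ℂ) *
          (((1 / Real.sqrt (2 * a) : ℝ) : ℂ) * Yoshida1992.fourierCoeff a m (fun x : ℝ ↦ ((x : ℂ)) ^ j)) := by
  rw [weilWindowSesq_eq, weilPoleSesq_indicator_pow_chi ha j m, sum_prime_weilIncrementSesq_indicator_pow_chi ha hm,
    setIntegral_weilArchDensity_mul_weilIncrementSesq_indicator_pow_chi ha hm, integral_indicator_pow_mul_conj_chi ha.le]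

/-- The transposed mixed entry by hermitian symmetry: `W_a(χ_m, 1x^j) = conj W_a(1x^j, χ_m)`. -/
theorem weilWindowSesq_chi_indicator_pow (a : ℝ) (m : ℤ) (j : ℕ) :
    weilWindowSesq a (chi a m) ((Icc (-a) a).indicator fun x : ℝ ↦ ((x : ℂ)) ^ j) =
      conj (weilWindowSesq a ((Icc (-a) a).indicator fun x : ℝ ↦ ((x : ℂ)) ^ j) (chi a m)) :=
  weilWindowSesq_conj_symm a _ _

end Summit.RiemannHypothesis.RiemannHypothesis.Theorems.WeilFormatC

end
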